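import Summits.QuantumFields.BalabanUV.Beta.GAN24.TransportIrrelevantSym
import Summits.QuantumFields.BalabanUV.Beta.GAN24.WSlotT2OfPieces
import Summits.QuantumFields.BalabanUV.Beta.GAN24.T2SlotOfHW

/-!
# `BalabanUV.Beta.GAN24.TransportRows` — binder row G-an2-4 / (CONV-C), W-slot road «W3» (gan24-p1-g5 `SKELETON-W3.md` v1.0.2 §8.3): **THE TWO F3 ROWS
# JOINTLY — ONE RATE PAIR `(δin, δT)` FOR `hTmarg` (ROW W3-F3a, leaf-10's `TransportMarginal.hTmarg_three`) AND `hTirr` (ROW W3-F3b, leaf-12's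
# `TransportIrrelevant.hTirr_three_slot` ∕ `TransportIrrelevantSym.hTirr_three_symZ_slot`) — AND THE SOCKET CERTIFICATES: both F3 slots of END #1
# `WSlotT2OfPieces.t2Shape_of_rows` and the F3 slot of END #2 `t2Drift_of_rows` FILLED BY NAME at `d = 3`**

NOT IN PRINT; OUR PROOF ([folklore] bookkeeping: `LocStencil₂.mono` in the rate and `min` of the two output rates; the ENDs' implicit rate letters
`{δin δT …}` are SHARED by `hTmarg`, `hTirr`, `hb`, `h0`, so an assembler needs the two F3 rows at ONE `δT` — this module is that one `obtain`).
HONEST FRAMING (cell contract, verbatim): «discharging `BetaPertH` makes Bałaban's UV stability UNCONDITIONAL — a real constructive-QFT result; it is NOT the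
continuum limit and NOT the Clay problem.»  HONEST DEPENDENCY (verbatim): «continuum YM on T⁴ ⇐ BetaPertH ∧ nine spine estimates (0/9 proved); BetaPertH ⇐
(D1) ∧ (D4) ∧ CAP+tail; G-an2-4 gates asym, D1 and NE2/3/4.»

## What is proved (`d = 3`; the transport of record `P m k := AffineUnroll.transport (fun j ↦ lin4 (cE₂·Lc^{2(3+1)}) (unitK (sfStep Lc j) (smStep 3 Lc j)
## (KInvStep Lc j)) Lc) m k`; inputs `1 ≤ Lc` (resp. `2 ≤ Lc` where `ρ = Lc⁻¹ < 1` is needed), the K-slot `UnitDecayK 3 Lc (sfStep Lc) (smStep 3 Lc) CK mK`, `mK > 0`,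
## ANY input rate `δin > 0` ((w8)∕(w10)), ANY `mom`)
* §1 `transport_rows_three` — `∃ CT CT′ δT, 0 ≤ CT ∧ 0 ≤ CT′ ∧ 0 < δT ∧ δT ≤ δin ∧ (pin → hTmarg-body at (CT, δin, δT)) ∧ (pin → hTirr-body at (CT′, ρ := Lc⁻¹, δin, δT))`
  with the RECORD `Zfree` (ref2 r57: jointly `Lc`-covariant ∧ `zmode Lc X κ κ′ ff = 0`) inline; `transport_rows_three_symZ` — the same with the weaker
  `ZfreeSym` (covariance ∧ vanishing BOND-SYMMETRISED ff charge).
* §2 SOCKET CERTIFICATES (END #1): **`t2Shape_three_of_rows_F3`** — «T2Shape» for an2's Stage-B family at `d = 3`, `Lc ≥ 2`, UNDER the pin, with the F3 slots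
  (`hTmarg`, `hTirr`) AND the member-0 slot `h0` (leaf-19's `T2SlotOfHW.locStencil₂_unitS₂_T2Of_zero`, F4c) DISCHARGED BY NAME and the remaining rows
  `hsplit` (F1a), `hb` (F4a), `hZ` (F2a, `ZfreeSym` form) kept as hypotheses VERBATIM in the END's binder shapes; `t2Shape_three_of_rows_F3_record` — the same
  with the record `Zfree` in `hZ`.
* §3 SOCKET CERTIFICATE (END #2, generic tower of differences): **`rate_three_of_rows_F3b`** — `WSlotT2OfPieces.rate_of_rows (d := 3)` with the F3b slot
  filled at the SHIFTED transport `P′ m k := P (m+1) k` (`ZfreeSym` form; under the pin — ref2 r57 R57-2: the difference tower carries `hpin` too; its own input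
  rate, (w10)), the rows `hsplit` (F1b), `hf` (F4b), `hZf` (F2b), `h0`∕`hZ0` (F4d) kept as hypotheses verbatim.
HONEST: compositions BY NAME; rows F1a∕F1b∕F4a∕F4b∕F2a∕F2b∕F4d and the pin remain HYPOTHESES of these certificates (F1a∕F1b∕F4a-shape are tree theorems of
other lineages — NOT restated or imported here: the owner's END #3 does that bookkeeping); NOTHING of «T2Shape»∕«T2SupRate»∕(hW₂, hW₂all) is discharged
unconditionally; NOT «W-slot closed», NEVER «G-an2-4 closed»; NOT `BetaPertH`, NOT continuum, NOT Clay.  0 cited facts, 0 `def`, 0 `def … : Prop`, 0 sorry.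
Unit `b2b-balaban-gan24-formalise-leaf-12` (G-an2-4 formalisation swarm, leaf prover 12, gen 21; ROW W3-F3b holder), 2026-08-20.
-/

noncomputable section

open Finset
open scoped BigOperators
open Literature.MathematicalPhysics.QuantumFieldTheory
open Literature.MathematicalPhysics.QuantumFieldTheory.Balaban1983to89
open Literature.MathematicalPhysics.QuantumFieldTheory.Balaban1983to89.Beta
open ExpKernelCalculus (MKer Decays shiftK)
open OneStepResolventKernel (Fib)
open OneStepKernelFamily (KInvStep)
open Summit.QuantumFields.BalabanUV.Beta.HessKerDressedUnits (unitK)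
open BalabanCompositeJets (LocStencil₂ LocStencil₂.nonneg)
open BalabanStepW2 (T2Of)
open AveragingMixedJetTables (vh₂S)
open Summit.QuantumFields.BalabanUV.Beta.SecondOrderUnits (unitS₂)
open Summit.QuantumFields.BalabanUV.Beta.GAN24.CombesThomas (UnitDecayK sfStep smStep)
open Summit.QuantumFields.BalabanUV.Beta.GAN24.T2RecursionAffine (lin4)
open Summit.QuantumFields.BalabanUV.Beta.GAN24.Push4Iter (BiTab)
open Summit.QuantumFields.BalabanUV.Beta.GAN24.AffineUnroll (transport)
open Summit.QuantumFields.BalabanUV.Beta.GAN24.BiStencilZeroMode (zmode)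
open Summit.QuantumFields.BalabanUV.Beta.GAN24.TransportMarginal (hTmarg_three)
open Summit.QuantumFields.BalabanUV.Beta.GAN24.TransportIrrelevant (hTirr_three_slot)
open Summit.QuantumFields.BalabanUV.Beta.GAN24.TransportIrrelevantSym (hTirr_three_symZ_slot zfreeSym_of_zfree)
open Summit.QuantumFields.BalabanUV.Beta.GAN24.WSlotT2OfPieces (t2Shape_of_rows rate_of_rows)
open Summit.QuantumFields.BalabanUV.Beta.GAN24.T2SlotOfHW (locStencil₂_unitS₂_T2Of_zero)

namespace Summit.QuantumFields.BalabanUV.Beta.GAN24.TransportRows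

/-! ## §0 The gain rate `ρ = Lc⁻¹` -/

/-- [folklore] `0 ≤ Lc⁻¹`. -/
theorem inv_natCast_nonneg {Lc : ℕ} : (0 : ℝ) ≤ ((Lc : ℝ))⁻¹ := by positivity

/-- [folklore] `Lc⁻¹ < 1` for `Lc ≥ 2` (the wall's standing hypothesis `2 ≤ Lc`). -/
theorem inv_natCast_lt_one {Lc : ℕ} (hLc : 2 ≤ Lc) : ((Lc : ℝ))⁻¹ < 1 :=
  inv_lt_one_of_one_lt₀ (by exact_mod_cast hLc)

section Three

variable {Lc : ℕ} [NeZero Lc] {CK mK : ℝ}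

/-! ## §1 The two F3 rows at one rate pair -/

/-- **ROWS W3-F3a ∧ W3-F3b AT ONE RATE PAIR, RECORD `Zfree`** (ref2 r57: `Zfree X := jointly Lc-covariant ∧ zmode Lc X κ κ′ ff = 0`): for every input rate
`δin > 0` there are `CT, CT′ ≥ 0` and ONE output rate `0 < δT ≤ δin` such that, under the pin `|cE₂| ≤ Lc^{2(3+1)}`, the transport of record is MARGINAL
(`LocStencil₂ (P m k X) (CT·C) δT`, leaf-10's `hTmarg_three`) on every `LocStencil₂ X C δin` and IRRELEVANT (`LocStencil₂ (P m k X) (CT′·C·(Lc⁻¹)^k) δT`, leaf-12's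
`hTirr_three_slot`) on those with the record `Zfree` (any `mom`).  [folklore] `min` of the two output rates + `LocStencil₂.mono`. -/
theorem transport_rows_three (hLc : 1 ≤ Lc) (hK : UnitDecayK 3 Lc (sfStep Lc) (smStep 3 Lc) CK mK) (hmK : 0 < mK) (cE₂ : ℝ) {δin : ℝ}
    (hδin : 0 < δin) (mom : BiTab 3 → ℝ) :
    ∃ CT CT' δT : ℝ, 0 ≤ CT ∧ 0 ≤ CT' ∧ 0 < δT ∧ δT ≤ δin ∧
      (|cE₂| ≤ (Lc : ℝ) ^ (2 * (3 + 1)) → ∀ (m k : ℕ) (X : BiTab 3) (C : ℝ), 0 ≤ C → LocStencil₂ X C δin →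
        LocStencil₂ (transport (fun j => lin4 (cE₂ * (Lc : ℝ) ^ (2 * (3 + 1)))
          (unitK (sfStep Lc j) (smStep 3 Lc j) (KInvStep (d := 3) Lc j)) Lc) m k X) (CT * C) δT) ∧
      (|cE₂| ≤ (Lc : ℝ) ^ (2 * (3 + 1)) → ∀ (m k : ℕ) (X : BiTab 3) (C : ℝ), 0 ≤ C → LocStencil₂ X C δin →
        ((∀ κ u κ' u' t, X κ (u + (Lc : ℤ) • t) κ' (u' + (Lc : ℤ) • t) = shiftK (-((Lc : ℤ) • t)) (X κ u κ' u')) ∧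
          (∀ κ κ' κ₁ κ₂, zmode Lc X κ κ' (Sum.inl κ₁) (Sum.inl κ₂) = 0)) → mom X ≤ C →
        LocStencil₂ (transport (fun j => lin4 (cE₂ * (Lc : ℝ) ^ (2 * (3 + 1)))
          (unitK (sfStep Lc j) (smStep 3 Lc j) (KInvStep (d := 3) Lc j)) Lc) m k X) (CT' * C * ((Lc : ℝ)⁻¹) ^ k) δT) := by
  obtain ⟨CT, δ₁, hCT, hδ₁, hδ₁in, h₁⟩ := hTmarg_three hLc hK hmK cE₂ hδin
  obtain ⟨CT', δ₂, hCT', hδ₂, -, h₂⟩ := hTirr_three_slot hLc hK hmK cE₂ hδin mom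
  exact ⟨CT, CT', min δ₁ δ₂, hCT, hCT', lt_min hδ₁ hδ₂, (min_le_left _ _).trans hδ₁in,
    fun hpin m k X C hC hX => (h₁ hpin m k X C hC hX).mono (min_le_left _ _),
    fun hpin m k X C hC hX hZ hm => (h₂ hpin m k X C hC hX hZ hm).mono (min_le_right _ _)⟩

/-- **ROWS W3-F3a ∧ W3-F3b AT ONE RATE PAIR, `ZfreeSym`** (`ZfreeSym X := jointly Lc-covariant ∧ zmode Lc X κ κ′ ff + zmode Lc X κ′ κ ff = 0`, leaf-12's
`TransportIrrelevantSym.hTirr_three_symZ_slot` — the weaker hypothesis, implied by the record `Zfree`). -/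
theorem transport_rows_three_symZ (hLc : 1 ≤ Lc) (hK : UnitDecayK 3 Lc (sfStep Lc) (smStep 3 Lc) CK mK) (hmK : 0 < mK) (cE₂ : ℝ) {δin : ℝ}
    (hδin : 0 < δin) (mom : BiTab 3 → ℝ) :
    ∃ CT CT' δT : ℝ, 0 ≤ CT ∧ 0 ≤ CT' ∧ 0 < δT ∧ δT ≤ δin ∧
      (|cE₂| ≤ (Lc : ℝ) ^ (2 * (3 + 1)) → ∀ (m k : ℕ) (X : BiTab 3) (C : ℝ), 0 ≤ C → LocStencil₂ X C δin →
        LocStencil₂ (transport (fun j => lin4 (cE₂ * (Lc : ℝ) ^ (2 * (3 + 1)))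
          (unitK (sfStep Lc j) (smStep 3 Lc j) (KInvStep (d := 3) Lc j)) Lc) m k X) (CT * C) δT) ∧
      (|cE₂| ≤ (Lc : ℝ) ^ (2 * (3 + 1)) → ∀ (m k : ℕ) (X : BiTab 3) (C : ℝ), 0 ≤ C → LocStencil₂ X C δin →
        ((∀ κ u κ' u' t, X κ (u + (Lc : ℤ) • t) κ' (u' + (Lc : ℤ) • t) = shiftK (-((Lc : ℤ) • t)) (X κ u κ' u')) ∧
          (∀ κ κ' κ₁ κ₂, zmode Lc X κ κ' (Sum.inl κ₁) (Sum.inl κ₂) + zmode Lc X κ' κ (Sum.inl κ₁) (Sum.inl κ₂) = 0)) → mom X ≤ C →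
        LocStencil₂ (transport (fun j => lin4 (cE₂ * (Lc : ℝ) ^ (2 * (3 + 1)))
          (unitK (sfStep Lc j) (smStep 3 Lc j) (KInvStep (d := 3) Lc j)) Lc) m k X) (CT' * C * ((Lc : ℝ)⁻¹) ^ k) δT) := by
  obtain ⟨CT, δ₁, hCT, hδ₁, hδ₁in, h₁⟩ := hTmarg_three hLc hK hmK cE₂ hδin
  obtain ⟨CT', δ₂, hCT', hδ₂, -, h₂⟩ := hTirr_three_symZ_slot hLc hK hmK cE₂ hδin mom
  exact ⟨CT, CT', min δ₁ δ₂, hCT, hCT', lt_min hδ₁ hδ₂, (min_le_left _ _).trans hδ₁in,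
    fun hpin m k X C hC hX => (h₁ hpin m k X C hC hX).mono (min_le_left _ _),
    fun hpin m k X C hC hX hZ hm => (h₂ hpin m k X C hC hX hZ hm).mono (min_le_right _ _)⟩

/-! ## §2 Socket certificates for END #1: «T2Shape» at `d = 3` with the F3 slots (and F4c) filled by name -/

/-- **SOCKET CERTIFICATE, END #1 (`ZfreeSym` form): «T2Shape» FOR an2's STAGE-B FAMILY AT `d = 3`, `Lc ≥ 2`, UNDER THE PIN, WITH ROWS W3-F3a, W3-F3b AND W3-F4c
DISCHARGED BY NAME** — `WSlotT2OfPieces.t2Shape_of_rows (d := 3)` at the transport of record, `Zfree := ZfreeSym`, `ρ := Lc⁻¹`, any `mom`, with `hTmarg`∕`hTirr` from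
`transport_rows_three_symZ` and `h0` from leaf-19's `T2SlotOfHW.locStencil₂_unitS₂_T2Of_zero` (F4c, any rate); the rows `hsplit` (F1a), `hb` (F4a) and `hZ` (F2a)
are the END's binders VERBATIM at this instantiation (their tree discharges live in other lineages' modules and the owner's END #3).  Inputs: `2 ≤ Lc`, the
K-slot `UnitDecayK 3 Lc (sfStep Lc) (smStep 3 Lc) CK mK` (`mK > 0`), the rows' common input rate `δin > 0`, the pin. -/
theorem t2Shape_three_of_rows_F3 (hLc : 2 ≤ Lc) (hK : UnitDecayK 3 Lc (sfStep Lc) (smStep 3 Lc) CK mK) (hmK : 0 < mK)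
    (cE cVH cΛ cE₂ cB : ℝ) (Tc : Fin 4 → Fin 4 → Fin 4 → Fin 4 → ℝ) (mixFF : BiTab 3) (b : ℕ → BiTab 3) (mom : BiTab 3 → ℝ)
    {δin Cb : ℝ} (hδin : 0 < δin) (hpin : |cE₂| ≤ (Lc : ℝ) ^ (2 * (3 + 1)))
    (hsplit : ∀ n, unitS₂ (sfStep Lc n) (smStep 3 Lc n) (T2Of 3 Lc cE cVH cΛ cE₂ cB Tc (vh₂S 3 Lc) mixFF n) =
      transport (fun j => lin4 (cE₂ * (Lc : ℝ) ^ (2 * (3 + 1))) (unitK (sfStep Lc j) (smStep 3 Lc j) (KInvStep (d := 3) Lc j)) Lc) 0 n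
          (unitS₂ (sfStep Lc 0) (smStep 3 Lc 0) (T2Of 3 Lc cE cVH cΛ cE₂ cB Tc (vh₂S 3 Lc) mixFF 0)) +
        ∑ i ∈ Finset.range n, transport (fun j => lin4 (cE₂ * (Lc : ℝ) ^ (2 * (3 + 1))) (unitK (sfStep Lc j) (smStep 3 Lc j) (KInvStep (d := 3) Lc j)) Lc)
          (i + 1) (n - 1 - i) (b i))
    (hb : ∀ m, LocStencil₂ (b m) Cb δin ∧ mom (b m) ≤ Cb)
    (hZ : ∀ m, (∀ κ u κ' u' t, b m κ (u + (Lc : ℤ) • t) κ' (u' + (Lc : ℤ) • t) = shiftK (-((Lc : ℤ) • t)) (b m κ u κ' u')) ∧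
      (∀ κ κ' κ₁ κ₂, zmode Lc (b m) κ κ' (Sum.inl κ₁) (Sum.inl κ₂) + zmode Lc (b m) κ' κ (Sum.inl κ₁) (Sum.inl κ₂) = 0)) :
    ∃ C₂ δ₂ : ℝ, 0 < δ₂ ∧ ∀ j, LocStencil₂ (unitS₂ (sfStep Lc j) (smStep 3 Lc j) (T2Of 3 Lc cE cVH cΛ cE₂ cB Tc (vh₂S 3 Lc) mixFF j)) C₂ δ₂ := by
  have hLc1 : 1 ≤ Lc := le_trans (by norm_num) hLc
  obtain ⟨CT, CT', δT, -, hCT', hδT, -, hT, hTirr⟩ := transport_rows_three_symZ hLc1 hK hmK cE₂ hδin mom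
  exact t2Shape_of_rows (d := 3) cE cVH cΛ cE₂ cB Tc mixFF b
    (transport (fun j => lin4 (cE₂ * (Lc : ℝ) ^ (2 * (3 + 1))) (unitK (sfStep Lc j) (smStep 3 Lc j) (KInvStep (d := 3) Lc j)) Lc))
    (fun X => (∀ κ u κ' u' t, X κ (u + (Lc : ℤ) • t) κ' (u' + (Lc : ℤ) • t) = shiftK (-((Lc : ℤ) • t)) (X κ u κ' u')) ∧
      (∀ κ κ' κ₁ κ₂, zmode Lc X κ κ' (Sum.inl κ₁) (Sum.inl κ₂) + zmode Lc X κ' κ (Sum.inl κ₁) (Sum.inl κ₂) = 0))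
    mom hδT hCT' inv_natCast_nonneg (inv_natCast_lt_one hLc) hpin hsplit hT (hTirr hpin) hb hZ
    (locStencil₂_unitS₂_T2Of_zero (d := 3) hLc1 cE cVH cΛ cE₂ cB Tc mixFF hδin.le)

/-- **SOCKET CERTIFICATE, END #1 (record-`Zfree` form)**: the same with `hZ : ∀ m, Zfree (b m)` in the record form (jointly `Lc`-covariant ∧ `zmode Lc (b m) κ κ′ ff = 0`)
— via `zfreeSym_of_zfree`. -/
theorem t2Shape_three_of_rows_F3_record (hLc : 2 ≤ Lc) (hK : UnitDecayK 3 Lc (sfStep Lc) (smStep 3 Lc) CK mK) (hmK : 0 < mK)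
    (cE cVH cΛ cE₂ cB : ℝ) (Tc : Fin 4 → Fin 4 → Fin 4 → Fin 4 → ℝ) (mixFF : BiTab 3) (b : ℕ → BiTab 3) (mom : BiTab 3 → ℝ)
    {δin Cb : ℝ} (hδin : 0 < δin) (hpin : |cE₂| ≤ (Lc : ℝ) ^ (2 * (3 + 1)))
    (hsplit : ∀ n, unitS₂ (sfStep Lc n) (smStep 3 Lc n) (T2Of 3 Lc cE cVH cΛ cE₂ cB Tc (vh₂S 3 Lc) mixFF n) =
      transport (fun j => lin4 (cE₂ * (Lc : ℝ) ^ (2 * (3 + 1))) (unitK (sfStep Lc j) (smStep 3 Lc j) (KInvStep (d := 3) Lc j)) Lc) 0 n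
          (unitS₂ (sfStep Lc 0) (smStep 3 Lc 0) (T2Of 3 Lc cE cVH cΛ cE₂ cB Tc (vh₂S 3 Lc) mixFF 0)) +
        ∑ i ∈ Finset.range n, transport (fun j => lin4 (cE₂ * (Lc : ℝ) ^ (2 * (3 + 1))) (unitK (sfStep Lc j) (smStep 3 Lc j) (KInvStep (d := 3) Lc j)) Lc)
          (i + 1) (n - 1 - i) (b i))
    (hb : ∀ m, LocStencil₂ (b m) Cb δin ∧ mom (b m) ≤ Cb)
    (hZ : ∀ m, (∀ κ u κ' u' t, b m κ (u + (Lc : ℤ) • t) κ' (u' + (Lc : ℤ) • t) = shiftK (-((Lc : ℤ) • t)) (b m κ u κ' u')) ∧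
      (∀ κ κ' κ₁ κ₂, zmode Lc (b m) κ κ' (Sum.inl κ₁) (Sum.inl κ₂) = 0)) :
    ∃ C₂ δ₂ : ℝ, 0 < δ₂ ∧ ∀ j, LocStencil₂ (unitS₂ (sfStep Lc j) (smStep 3 Lc j) (T2Of 3 Lc cE cVH cΛ cE₂ cB Tc (vh₂S 3 Lc) mixFF j)) C₂ δ₂ :=
  t2Shape_three_of_rows_F3 hLc hK hmK cE cVH cΛ cE₂ cB Tc mixFF b mom hδin hpin hsplit hb (fun m => zfreeSym_of_zfree (hZ m))

/-! ## §3 Socket certificate for END #2 (generic difference tower): the F3b slot filled at the shifted transport -/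

/-- **SOCKET CERTIFICATE, END #2 (`ZfreeSym` form, generic tower of DIFFERENCES): `WSlotT2OfPieces.rate_of_rows (d := 3)` WITH ROW W3-F3b DISCHARGED BY NAME AT
THE SHIFTED TRANSPORT `P′ m k := P (m+1) k`** — for ANY tower `D` unrolled through `P′` with forcing `f` (`hsplit` = ROW W3-F1b's shape), forcing rows `hf` (F4b),
`hZf` (F2b) and first-difference rows `h0`∕`hZ0` (F4d) as hypotheses VERBATIM in the END's binder shapes (`Zfree := ZfreeSym`, any `mom`), under the pin
(F3b is pin-conditional, ref2 r57 R57-2) and with the difference tower's OWN input rate `δin > 0` ((w10)): `∃ c ϑ δT, 0 ≤ c ∧ 0 < ϑ < 1 ∧ 0 < δT ≤ δin ∧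
∀ n, LocStencil₂ (D n) (c·ϑ^n) δT`.  At `D n := T♮_{n+1} − T♮_n` this is the one-step «T2Drift» of `t2Drift_of_rows` (Cauchy and sup forms follow there by
`cauchy_of_rate` ∕ `sup_of_locStencil₂`).  Inputs: `2 ≤ Lc`, the K-slot, `mK > 0`. -/
theorem rate_three_of_rows_F3b (hLc : 2 ≤ Lc) (hK : UnitDecayK 3 Lc (sfStep Lc) (smStep 3 Lc) CK mK) (hmK : 0 < mK) (cE₂ : ℝ)
    (D f : ℕ → BiTab 3) (mom : BiTab 3 → ℝ) {δin θ Cf C₀ : ℝ} (hδin : 0 < δin) (hθ0 : 0 ≤ θ) (hθ1 : θ < 1)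
    (hpin : |cE₂| ≤ (Lc : ℝ) ^ (2 * (3 + 1)))
    (hsplit : ∀ n, D n =
      transport (fun j => lin4 (cE₂ * (Lc : ℝ) ^ (2 * (3 + 1))) (unitK (sfStep Lc j) (smStep 3 Lc j) (KInvStep (d := 3) Lc j)) Lc) (0 + 1) n (D 0) +
        ∑ i ∈ Finset.range n, transport (fun j => lin4 (cE₂ * (Lc : ℝ) ^ (2 * (3 + 1))) (unitK (sfStep Lc j) (smStep 3 Lc j) (KInvStep (d := 3) Lc j)) Lc)
          (i + 1 + 1) (n - 1 - i) (f i))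
    (hf : ∀ m, LocStencil₂ (f m) (Cf * θ ^ m) δin ∧ mom (f m) ≤ Cf * θ ^ m)
    (hZf : ∀ m, (∀ κ u κ' u' t, f m κ (u + (Lc : ℤ) • t) κ' (u' + (Lc : ℤ) • t) = shiftK (-((Lc : ℤ) • t)) (f m κ u κ' u')) ∧
      (∀ κ κ' κ₁ κ₂, zmode Lc (f m) κ κ' (Sum.inl κ₁) (Sum.inl κ₂) + zmode Lc (f m) κ' κ (Sum.inl κ₁) (Sum.inl κ₂) = 0))
    (h0 : LocStencil₂ (D 0) C₀ δin ∧ mom (D 0) ≤ C₀)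
    (hZ0 : (∀ κ u κ' u' t, D 0 κ (u + (Lc : ℤ) • t) κ' (u' + (Lc : ℤ) • t) = shiftK (-((Lc : ℤ) • t)) (D 0 κ u κ' u')) ∧
      (∀ κ κ' κ₁ κ₂, zmode Lc (D 0) κ κ' (Sum.inl κ₁) (Sum.inl κ₂) + zmode Lc (D 0) κ' κ (Sum.inl κ₁) (Sum.inl κ₂) = 0)) :
    ∃ c ϑ δT : ℝ, 0 ≤ c ∧ 0 < ϑ ∧ ϑ < 1 ∧ 0 < δT ∧ δT ≤ δin ∧ ∀ n, LocStencil₂ (D n) (c * ϑ ^ n) δT := by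
  have hLc1 : 1 ≤ Lc := le_trans (by norm_num) hLc
  obtain ⟨CT', δT, hCT', hδT, hδTin, h⟩ := hTirr_three_symZ_slot hLc1 hK hmK cE₂ hδin mom
  obtain ⟨c, ϑ, hc, hϑ0, hϑ1, hD⟩ := rate_of_rows (d := 3) D f
    (fun m k => transport (fun j => lin4 (cE₂ * (Lc : ℝ) ^ (2 * (3 + 1))) (unitK (sfStep Lc j) (smStep 3 Lc j) (KInvStep (d := 3) Lc j)) Lc) (m + 1) k)
    (fun X => (∀ κ u κ' u' t, X κ (u + (Lc : ℤ) • t) κ' (u' + (Lc : ℤ) • t) = shiftK (-((Lc : ℤ) • t)) (X κ u κ' u')) ∧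
      (∀ κ κ' κ₁ κ₂, zmode Lc X κ κ' (Sum.inl κ₁) (Sum.inl κ₂) + zmode Lc X κ' κ (Sum.inl κ₁) (Sum.inl κ₂) = 0))
    mom hCT' inv_natCast_nonneg (inv_natCast_lt_one hLc) hθ0 hθ1 hsplit (fun m k X C hC hX hZ hm => h hpin (m + 1) k X C hC hX hZ hm) hf hZf h0 hZ0
  exact ⟨c, ϑ, δT, hc, hϑ0, hϑ1, hδT, hδTin, hD⟩

end Three

end Summit.QuantumFields.BalabanUV.Beta.GAN24.TransportRows

end
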